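import Summits.BirchSwinnertonDyer.Rank1Residual.GaloisImage.PadicRootCensusTaylor
import HarnessLib

/-!
# The ROOT CENSUS theorem: the roots of `F ∈ ℤ[X]` in `ℤ_p` are EXACTLY the certified Hensel
# roots (team n1011, row T-LOC3T, FILE A2 — generic in the prime `p`)

HONEST FRAMING (cell `b2b-bsdres`, run/shared/lean/b2b/bsd-rank1-residual/, verbatim in every
file): the goal of the cell is to DELETE the COMBINATION-SHAPED residual classes of the
Birch–Swinnerton-Dyer formula for ALL analytic-rank `≤ 1` elliptic curves over `ℚ` — "full BSD
formula for every rank `≤ 1` curve in class `C`" assembled STRICTLY from published theorems — so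
that the rank-`≤ 1` remainder becomes exactly the CONSTRUCTION-SHAPED classes, which are TYPED
(missing-input `Prop`s), NOT attempted. This is not "finishing BSD". Team n1011 (N10/N11): research
route; this file is a TOOL (pure `p`-adic algebra); nothing is booked by it; no mark / label moved.
THEOREMS ONLY: no definition, no named fact, no `sorry`.

## What

`RootCensus.exists_roots_of_check` / `exists_roots_of_check₂`: if the computable checker
`RootCensus.check p l k cert` of FILE A1 (`PadicRootCensus`) — or `check₂` of FILE A1b
(`PadicRootCensusTaylor`, with the Taylor exclusion test) — returns `true`, then there are `p`-adic
integers `ρ 0, …, ρ (n-1)`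
(`n = cert.length`), pairwise distinct, with `F(ρ i) = 0` (`F = ofList l`),
`‖ρ i - cᵢ‖ < p^{-mᵢ}` (the Hensel ball) and `‖ρ i - cᵢ‖ ≤ p^{-(Nᵢ - mᵢ)}` (a-posteriori
precision), and EVERY root of `F` in `ℤ_p` is one of them. Ingredients: Mathlib's `hensels_lemma`
with `R := ℤ` (existence + uniqueness in the ball `‖z - c‖ < ‖F′(c)‖`), FILE A1's
`norm_aeval_eq_mul_of_root` (precision), `pairwise_of_pairwiseOK` (distinctness) and
`inBall_of_coverOK` (completeness, by the residue tree search).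

Consumer: `LocalThreeTorsionDecider` (the `ℚ₃`-rational `3`-torsion count, row binder `ht` of
route 1's records, r1 ROUTE-1 §27.2). References: Hensel's lemma (J. W. S. Cassels, *Local Fields*,
LMSST 3 (1986), Ch. 4 §3).
-/

set_option autoImplicit false

open Polynomial

namespace Summit.BirchSwinnertonDyer.Rank1Residual.GaloisImage.RootCensus

variable {p : ℕ} [hp : Fact p.Prime]

/-! ### The theorem -/

/-- `p^{-(n:ℤ)}` bookkeeping: `p^{-a} < p^{-b} ↔ b < a`, etc. We use `1 < p`. -/
private theorem one_lt_p : (1 : ℝ) < p := by exact_mod_cast hp.out.one_lt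

/-- **ROOT CENSUS, core form.** If every entry of `cert` passes `entryOK`, the balls are pairwise
disjoint (`pairwiseOK`) and every root of `F = ofList l` in `ℤ_p` lies in some certified ball, then
the roots of `F` in `ℤ_p` are exactly `n = cert.length` pairwise distinct Hensel roots `ρ i`, the
`i`-th within `p^{-(Nᵢ - mᵢ)}` of the certified approximation `cᵢ`. [folklore] -/
theorem exists_roots_of_cover (l : List ℤ) (k : ℕ) (cert : List (ℤ × ℕ × ℕ))
    (hent : ∀ e ∈ cert, entryOK p l k e = true) (hpw : pairwiseOK p cert = true)
    (hcov : ∀ z : ℤ_[p], aeval z (ofList l) = 0 →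
      ∃ e ∈ cert, ‖z - (e.1 : ℤ_[p])‖ ≤ (p : ℝ) ^ (-((e.2.1 + 1 : ℕ) : ℤ))) :
    ∃ ρ : Fin cert.length → ℤ_[p], Function.Injective ρ ∧
      (∀ i, aeval (ρ i) (ofList l) = 0 ∧
        ‖ρ i - ((cert.get i).1 : ℤ_[p])‖ < (p : ℝ) ^ (-((cert.get i).2.1 : ℤ)) ∧
        ‖ρ i - ((cert.get i).1 : ℤ_[p])‖ ≤
          (p : ℝ) ^ (-(((cert.get i).2.2 - (cert.get i).2.1 : ℕ) : ℤ))) ∧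
      ∀ z : ℤ_[p], aeval z (ofList l) = 0 → ∃ i, ρ i = z := by
  have hp1 := one_lt_p (p := p)
  set F := ofList l with hF
  -- per entry: norms and Hensel
  have key : ∀ i : Fin cert.length,
      ‖aeval ((cert.get i).1 : ℤ_[p]) F.derivative‖ = (p : ℝ) ^ (-((cert.get i).2.1 : ℤ)) ∧
      ‖aeval ((cert.get i).1 : ℤ_[p]) F‖ ≤ (p : ℝ) ^ (-((cert.get i).2.2 : ℤ)) ∧
      ‖aeval ((cert.get i).1 : ℤ_[p]) F‖ < ‖aeval ((cert.get i).1 : ℤ_[p]) F.derivative‖ ^ 2 ∧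
      (cert.get i).2.1 < k ∧ 2 * (cert.get i).2.1 + 1 ≤ (cert.get i).2.2 := by
    intro i
    obtain ⟨hmk, hN, hdm, hndm, hdN⟩ := entryOK_spec (hent _ (List.get_mem cert i))
    have h1 : ‖aeval ((cert.get i).1 : ℤ_[p]) F.derivative‖ =
        (p : ℝ) ^ (-((cert.get i).2.1 : ℤ)) := by
      rw [hF, aeval_intCast_derivative_ofList]; exact norm_intCast_eq_of_dvd_of_not_dvd hdm hndm
    have h2 : ‖aeval ((cert.get i).1 : ℤ_[p]) F‖ ≤ (p : ℝ) ^ (-((cert.get i).2.2 : ℤ)) := by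
      rw [hF, aeval_intCast_ofList]; exact norm_intCast_le_of_dvd hdN
    refine ⟨h1, h2, ?_, hmk, hN⟩
    rw [h1, ← zpow_natCast, ← zpow_mul]
    refine h2.trans_lt (zpow_lt_zpow_right₀ hp1 ?_)
    push_cast; omega
  -- the Hensel roots
  choose ρ hρ0 hρlt _ hρuniq using fun i : Fin cert.length => hensels_lemma (key i).2.2.1
  have hρle : ∀ i, ‖ρ i - ((cert.get i).1 : ℤ_[p])‖ ≤
      (p : ℝ) ^ (-(((cert.get i).2.2 - (cert.get i).2.1 : ℕ) : ℤ)) := by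
    intro i
    obtain ⟨h1, h2, -, -, hN⟩ := key i
    have hprec := norm_aeval_eq_mul_of_root F (hρ0 i) (hρlt i)
    rw [h1] at hprec
    have hpow : (0 : ℝ) < (p : ℝ) ^ (-((cert.get i).2.1 : ℤ)) := zpow_pos (by positivity) _
    have : ‖ρ i - ((cert.get i).1 : ℤ_[p])‖ = ‖aeval ((cert.get i).1 : ℤ_[p]) F‖ /
        (p : ℝ) ^ (-((cert.get i).2.1 : ℤ)) := by
      rw [hprec, mul_div_cancel_left₀ _ hpow.ne']
    rw [this, div_le_iff₀ hpow, ← zpow_add₀ (by positivity)]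
    refine h2.trans (zpow_le_zpow_right₀ hp1.le ?_)
    omega
  refine ⟨ρ, ?_, fun i => ⟨hρ0 i, (key i).1 ▸ hρlt i, hρle i⟩, ?_⟩
  · -- injective, from pairwise disjointness of the balls
    intro i j hij
    by_contra hne
    have hpw' := pairwise_of_pairwiseOK hpw
    rw [List.pairwise_iff_getElem] at hpw'
    -- arrange `i < j` or `j < i`
    have main : ∀ i j : Fin cert.length, ρ i = ρ j → i.1 < j.1 → False := by
      intro i j hij hlt
      have hdis := hpw' i j i.2 j.2 hlt
      have hi := hρlt i
      have hj := hρlt j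
      rw [(key i).1] at hi
      rw [(key j).1] at hj
      rw [hij] at hi
      -- ‖cᵢ - cⱼ‖ < p^{-min}
      have hlt' : ‖((cert.get i).1 : ℤ_[p]) - ((cert.get j).1 : ℤ_[p])‖ <
          (p : ℝ) ^ (-((min (cert.get i).2.1 (cert.get j).2.1 : ℕ) : ℤ)) := by
        have : ((cert.get i).1 : ℤ_[p]) - ((cert.get j).1 : ℤ_[p]) =
            (ρ j - ((cert.get j).1 : ℤ_[p])) + -(ρ j - ((cert.get i).1 : ℤ_[p])) := by ring
        rw [this]
        refine (PadicInt.nonarchimedean _ _).trans_lt (max_lt ?_ ?_)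
        · exact hj.trans_le (zpow_le_zpow_right₀ hp1.le (by push_cast; omega))
        · rw [norm_neg]
          exact hi.trans_le (zpow_le_zpow_right₀ hp1.le (by push_cast; omega))
      have hle : ‖(((cert.get i).1 - (cert.get j).1 : ℤ) : ℤ_[p])‖ ≤
          (p : ℝ) ^ (-((min (cert.get i).2.1 (cert.get j).2.1 + 1 : ℕ) : ℤ)) := by
        have hexp : (-((min (cert.get i).2.1 (cert.get j).2.1 + 1 : ℕ) : ℤ)) + 1 =
            -((min (cert.get i).2.1 (cert.get j).2.1 : ℕ) : ℤ) := by push_cast; ring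
        rw [PadicInt.norm_le_pow_iff_norm_lt_pow_add_one, hexp, Int.cast_sub]
        exact hlt'
      have := PadicInt.norm_int_le_pow_iff_dvd.mp hle
      simp only [List.get_eq_getElem] at this
      exact hdis this
    rcases lt_trichotomy i.1 j.1 with hlt | heq | hgt
    · exact main i j hij hlt
    · exact hne (Fin.ext heq)
    · exact main j i hij.symm hgt
  · -- completeness, from the residue check
    intro z hz
    obtain ⟨e, he, hze⟩ := hcov z hz
    obtain ⟨i, hi⟩ := List.get_of_mem he
    refine ⟨i, (hρuniq i z hz ?_).symm⟩
    rw [(key i).1, hi]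
    exact hze.trans_lt (zpow_lt_zpow_right₀ hp1 (by push_cast; omega))

/-- **ROOT CENSUS** for the checker `RootCensus.check` (plain residue tree search). [folklore] -/
theorem exists_roots_of_check (l : List ℤ) (k : ℕ) (cert : List (ℤ × ℕ × ℕ))
    (h : check p l k cert = true) :
    ∃ ρ : Fin cert.length → ℤ_[p], Function.Injective ρ ∧
      (∀ i, aeval (ρ i) (ofList l) = 0 ∧
        ‖ρ i - ((cert.get i).1 : ℤ_[p])‖ < (p : ℝ) ^ (-((cert.get i).2.1 : ℤ)) ∧
        ‖ρ i - ((cert.get i).1 : ℤ_[p])‖ ≤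
          (p : ℝ) ^ (-(((cert.get i).2.2 - (cert.get i).2.1 : ℕ) : ℤ))) ∧
      ∀ z : ℤ_[p], aeval z (ofList l) = 0 → ∃ i, ρ i = z := by
  simp only [check, Bool.and_eq_true, List.all_eq_true] at h
  obtain ⟨⟨hent, hpw⟩, hcov⟩ := h
  exact exists_roots_of_cover l k cert hent hpw (inBall_of_coverOK hcov)

/-- **ROOT CENSUS** for the checker `RootCensus.check₂` (residue tree search with the Taylor
exclusion test, FILE A1b). [folklore] -/
theorem exists_roots_of_check₂ (l : List ℤ) (k : ℕ) (cert : List (ℤ × ℕ × ℕ))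
    (h : check₂ p l k cert = true) :
    ∃ ρ : Fin cert.length → ℤ_[p], Function.Injective ρ ∧
      (∀ i, aeval (ρ i) (ofList l) = 0 ∧
        ‖ρ i - ((cert.get i).1 : ℤ_[p])‖ < (p : ℝ) ^ (-((cert.get i).2.1 : ℤ)) ∧
        ‖ρ i - ((cert.get i).1 : ℤ_[p])‖ ≤
          (p : ℝ) ^ (-(((cert.get i).2.2 - (cert.get i).2.1 : ℕ) : ℤ))) ∧
      ∀ z : ℤ_[p], aeval z (ofList l) = 0 → ∃ i, ρ i = z := by
  simp only [check₂, Bool.and_eq_true, List.all_eq_true] at h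
  obtain ⟨⟨hent, hpw⟩, hcov⟩ := h
  exact exists_roots_of_cover l k cert hent hpw (inBall_of_coverOK₂ hcov)

end Summit.BirchSwinnertonDyer.Rank1Residual.GaloisImage.RootCensus
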